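import Summits.Ventures.Crystal3D.Theorems.StickyWulffConstantGenericWallFloorCoreResidual
import Summits.Ventures.Crystal3D.Theorems.StickyWulffConstantGenericWallFloorStackLedgerCrossWith
import HarnessLib

/-!
# Restatement programme, GENERIC cone, cells G1a/G1b: the two one-sided `Σ9` classes AT explicit constants

HONEST FRAMING. Venture `Summits/Ventures/Crystal3D` (cell `crystal3d-full`); helper `--supports` the crux `GenericWallFloor`
(stmt-Ventures-19480, line `WallLedgerG`) and lane T's uniform port (cf-p1 DECISION (lxvii)(2) and 01:24:52Z P5: the (β-iii)
carve-out `BilayerWallBetaIIIAt` needs the six `Σ9` cells and `SeparatedWideAt` with ONE constant for all pairs).  Rung credit only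
(census-free, standard axioms); F-C1 not moved; E1 (`ExactOnly`) and `StarPairFar` stay BY NAME; `InPlaneTwinStarPair` is discharged by
`inPlaneTwinStarPair_holds` exactly as in `…Sigma9Holds`.

* `twoSlabLedgerWith_one_sigma9_of_far` / `twoSlabLedgerWith_one_sigma9Down_of_far` — `genericWallFloorAtCharge_one_sigma9{,Down}_of_far`
  (…Sigma9Full / …Sigma9FullDown) VERBATIM with the priced-cross leaf taken in With-currency (`twoSlabAdhesionWith_stackLedger_cross`,
  p685893): conclusion `TwoSlabLedgerWith C 10 1 A₁ t₁ A₂ t₂`, ONE `C` for all data.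
* **`twoSlabLedgerWith_of_sigma9OneSidedAt`** / **`twoSlabLedgerWith_of_sigma9OneSidedDownAt`** — the CLASS forms: one `C` with
  `Sigma9OneSidedAt A₁ A₂ → TwoSlabLedgerWith C 10 1 A₁ t₁ A₂ t₂` for all translations (resp. `Down`), modulo `ExactOnly`, `StarPairFar`.
WHAT THIS IS NOT: no new mathematics (proof bodies verbatim); not the stub; F-C1 not moved.
-/

noncomputable section

namespace Summit.Ventures.Crystal3D.Theorems

open Summit.Ventures.Crystal3D Finset
open Literature.MathematicalPhysics.StatisticalMechanics (fccStacking barlowStacking IsHaggSeq contactDeficiency)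
open scoped InnerProductSpace

open scoped Classical in
/-- **The lower one-sided `Σ9` cell at explicit constants** (`genericWallFloorAtCharge_one_sigma9_of_far` verbatim, conclusion
`TwoSlabLedgerWith C 10 1`; modulo `ExactOnly`(C12-55), `StarPairFar`, `InPlaneTwinStarPair`). -/
theorem twoSlabLedgerWith_one_sigma9_of_far : ∃ C : ℝ, ∀
    {s₀ : EuclideanSpace ℝ (Fin 3)} (hs₀ : s₀ ∈ fccSlots)
    (hcert : ExactOnly 0 (fccSlots.filter fun w => 0 < ⟪w, s₀⟫_ℝ)) (hfar : StarPairFar) (htw : InPlaneTwinStarPair)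
    (A₁ : EuclideanSpace ℝ (Fin 3) ≃ₗᵢ[ℝ] EuclideanSpace ℝ (Fin 3)) (t₁ : EuclideanSpace ℝ (Fin 3))
    (A₂ : EuclideanSpace ℝ (Fin 3) ≃ₗᵢ[ℝ] EuclideanSpace ℝ (Fin 3)) (t₂ : EuclideanSpace ℝ (Fin 3))
    {u₁ : EuclideanSpace ℝ (Fin 3)} (hu₁ : u₁ ∈ fccSlots)
    (hsteep₁ : Real.sqrt 2 / 2 ≤ ⟪A₁ u₁, EuclideanSpace.single (2 : Fin 3) (1 : ℝ)⟫_ℝ)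
    {u₂ : EuclideanSpace ℝ (Fin 3)} (hu₂ : u₂ ∈ fccSlots)
    (hsteep₂ : ⟪A₂ u₂, EuclideanSpace.single (2 : Fin 3) (1 : ℝ)⟫_ℝ ≤ -(Real.sqrt 2 / 2))
    (μk μk1 : EuclideanSpace ℝ (Fin 3))
    (hκl : ∀ μ ∈ [μk, μk1], ‖μ‖ = 1 ∧
      ∀ w ∈ fccSlots, ⟪w, μ⟫_ℝ = 0 ∨ ⟪w, μ⟫_ℝ = Real.sqrt (2 / 3) ∨ ⟪w, μ⟫_ℝ = -Real.sqrt (2 / 3))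
    (hκc : List.IsChain (fun μ μ' => ⟪μ, μ'⟫_ℝ = 1 / 3 ∨ ⟪μ, μ'⟫_ℝ = -1 / 3) [μk, μk1])
    (hA₂ : A₂ '' fccStacking 1 (Real.sqrt (2 / 3)) = (wordFrame A₁ [μk, μk1]) '' fccStacking 1 (Real.sqrt (2 / 3)))
    (hfirst : ⟪u₁, μk1⟫_ℝ = 0)
    (hsecond : ∀ n₁ : EuclideanSpace ℝ (Fin 3),
      (n₁ = wordFrame A₁ [μk, μk1] μk ∨ n₁ = -wordFrame A₁ [μk, μk1] μk) → ⟪A₂ u₂, n₁⟫_ℝ = Real.sqrt (2 / 3) →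
      ∀ q ∈ fccSlots, 0 < ⟪twinFrame A₂ n₁ q, n₁⟫_ℝ →
        (∀ q' ∈ fccSlots, 0 < ⟪twinFrame A₂ n₁ q', n₁⟫_ℝ →
          ⟪twinFrame A₂ n₁ q', -EuclideanSpace.single (2 : Fin 3) (1 : ℝ)⟫_ℝ ≤
            ⟪twinFrame A₂ n₁ q, -EuclideanSpace.single (2 : Fin 3) (1 : ℝ)⟫_ℝ) →
        (wordFrame A₁ [μk, μk1]).symm (A₂ ((twinFrame A₂ n₁).symm ((2 * Real.sqrt (2 / 3)) • twinFrame A₂ n₁ q - n₁))) ≠ μk1 ∧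
        (wordFrame A₁ [μk, μk1]).symm (A₂ ((twinFrame A₂ n₁).symm ((2 * Real.sqrt (2 / 3)) • twinFrame A₂ n₁ q - n₁))) ≠ -μk1)
    (hcap : ∀ n₁ : EuclideanSpace ℝ (Fin 3),
      (n₁ = wordFrame A₁ [μk, μk1] μk ∨ n₁ = -wordFrame A₁ [μk, μk1] μk) → ⟪A₂ u₂, n₁⟫_ℝ = Real.sqrt (2 / 3) →
      ∀ q ∈ fccSlots, 0 < ⟪twinFrame A₂ n₁ q, n₁⟫_ℝ →
        (∀ q' ∈ fccSlots, 0 < ⟪twinFrame A₂ n₁ q', n₁⟫_ℝ →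
          ⟪twinFrame A₂ n₁ q', -EuclideanSpace.single (2 : Fin 3) (1 : ℝ)⟫_ℝ ≤
            ⟪twinFrame A₂ n₁ q, -EuclideanSpace.single (2 : Fin 3) (1 : ℝ)⟫_ℝ) →
        ⟪twinFrame A₂ n₁ q, A₁ μk1⟫_ℝ = 0),
    TwoSlabLedgerWith C 10 1 A₁ t₁ A₂ t₂ := by
  obtain ⟨K, hK⟩ := twoSlabAdhesionWith_stackLedger_cross
  refine ⟨(240 * Real.sqrt 2 * Real.pi + 4440 * (4 * 10 + 2)) / 2 + 2000 + K, ?_⟩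
  intro s₀ hs₀ hcert hfar htw A₁ t₁ A₂ t₂ u₁ hu₁ hsteep₁ u₂ hu₂ hsteep₂ μk μk1 hκl hκc hA₂ hfirst hsecond hcap
  set e₃ : EuclideanSpace ℝ (Fin 3) := EuclideanSpace.single (2 : Fin 3) (1 : ℝ) with he₃
  have hκ2 : 2 ≤ [μk, μk1].length := by simp
  have hfirst' : ∀ μ, [μk, μk1].getLast? = some μ → ⟪u₁, μ⟫_ℝ = 0 := fun μ hμ => by
    simp at hμ; rw [← hμ]; exact hfirst
  have hsteep₂' : Real.sqrt 2 / 2 ≤ ⟪A₂ u₂, -e₃⟫_ℝ := by rw [inner_neg_right]; linarith only [hsteep₂]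
  -- the trivial grain-1 stack
  have hS₀ : StackSound e₃ [⟨A₁, u₁, 0⟩] := ⟨hu₁, hsteep₁⟩
  have hW₀ : StackWF e₃ [⟨A₁, u₁, 0⟩] := rfl
  -- (a) no grain-1 stack frame is `A₂·Λ₀`
  have hfar₁ : ∀ stk : List WalkEntry, StackSound e₃ stk → StackWF e₃ stk → stk.getLast? = some ⟨A₁, u₁, 0⟩ →
      ∀ e ∈ stk, e.frame '' fccStacking 1 (Real.sqrt (2 / 3)) ≠ A₂ '' fccStacking 1 (Real.sqrt (2 / 3)) :=
    fun stk hS hW hl e he => image_ne_of_word [μk, μk1] hκl hκc hκ2 hA₂ hfirst' hS hW hl he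
  -- (b) no grain-2 stack frame is `A₁·Λ₀`: it would be co-axial with the bare bottom, hence the twin of `A₁·Λ₀`
  have hfar₂ : ∀ stk : List WalkEntry, StackSound (-e₃) stk → StackWF (-e₃) stk → stk.getLast? = some ⟨A₂, u₂, 0⟩ →
      ∀ e ∈ stk, e.frame '' fccStacking 1 (Real.sqrt (2 / 3)) ≠ A₁ '' fccStacking 1 (Real.sqrt (2 / 3)) := by
    intro stk hS hW hl e he hEq
    obtain ⟨r, hS', hW', hl'⟩ := exists_suffix_of_mem stk e he hS hW
    rw [hl] at hl'
    have hco := coaxial_linear_of_image_eq (F₁ := (⟨A₁, u₁, 0⟩ : WalkEntry).frame) (F₂ := e.frame) hEq.symm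
    obtain ⟨hν, hmenu, himg, -, -⟩ := inPlaneTwin_of_coaxial_sigma9 μk μk1 hκl hκc hA₂ hfirst hsecond hcap
      hS₀ hW₀ rfl hS' hW' hl' hco
    exact image_twinFrame_ne A₁ hν hmenu (himg.symm.trans hEq)
  -- (c) the priced cross pairs
  have hledger := hK hs₀ hcert (doubleStarCoaxialAt_of_starPairFar hfar)
    (capPairCoaxial_of_starPairFar hfar) A₁ t₁ A₂ t₂ hu₁ hsteep₁ hu₂ hsteep₂ hfar₁ hfar₂
    (fun stk₁ stk₂ e₁ e₂ rest₁ rest₂ hS₁ hW₁ hl₁ hst₁ hS₂ hW₂ hl₂ hst₂ => by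
      by_cases hco : ∃ (L : EuclideanSpace ℝ (Fin 3) ≃ₗᵢ[ℝ] EuclideanSpace ℝ (Fin 3))
          (s₁ s₂ : EuclideanSpace ℝ (Fin 3)) (σ σ' : ℤ → ℤ), IsHaggSeq σ ∧ IsHaggSeq σ' ∧
          e₁.frame '' fccStacking 1 (Real.sqrt (2 / 3)) ⊆ (fun p => L p + s₁) '' barlowStacking 1 (Real.sqrt (2 / 3)) σ ∧
          e₂.frame '' fccStacking 1 (Real.sqrt (2 / 3)) ⊆ (fun p => L p + s₂) '' barlowStacking 1 (Real.sqrt (2 / 3)) σ'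
      · right
        subst hst₁; subst hst₂
        obtain ⟨hν, hmenu, himg, hd₁, hd₂⟩ := inPlaneTwin_of_coaxial_sigma9 μk μk1 hκl hκc hA₂ hfirst hsecond hcap
          hS₁ hW₁ hl₁ hS₂ hW₂ hl₂ hco
        intro Y hY y hy hown₁ hown₂
        exact ⟨starSet_ne_of_inPlaneTwin hν hmenu himg hS₁.top.1 hd₁,
          cover_of_inPlaneTwinStarPair htw hY hν hmenu himg hS₁.top.1 hS₂.top.1 hd₁ hd₂ hy hown₁ hown₂⟩
      · exact Or.inl hco)
  -- (d) the skeleton composition and the charge `½(κ₁ + κ₂) ≥ 1`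
  have hκ₁ := one_le_flux_of_steep (A := A₁) (u := u₁) (le_trans hsteep₁ (le_abs_self _))
  have hκ₂ : 1 ≤ Real.sqrt 2 * |⟪A₂ u₂, EuclideanSpace.single (2 : Fin 3) (1 : ℝ)⟫_ℝ| := by
    refine one_le_flux_of_steep (A := A₂) (u := u₂) ?_
    rw [abs_of_nonpos (by linarith only [hsteep₂, Real.sqrt_nonneg 2] :
      ⟪A₂ u₂, EuclideanSpace.single (2 : Fin 3) (1 : ℝ)⟫_ℝ ≤ 0)]
    linarith only [hsteep₂]
  exact twoSlabLedgerWith_anti (by linarith only [hκ₁, hκ₂]) hledger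

open scoped Classical in
/-- **The upper one-sided `Σ9` cell at explicit constants** (`genericWallFloorAtCharge_one_sigma9Down_of_far` verbatim). -/
theorem twoSlabLedgerWith_one_sigma9Down_of_far : ∃ C : ℝ, ∀
    {s₀ : EuclideanSpace ℝ (Fin 3)} (hs₀ : s₀ ∈ fccSlots)
    (hcert : ExactOnly 0 (fccSlots.filter fun w => 0 < ⟪w, s₀⟫_ℝ)) (hfar : StarPairFar) (htw : InPlaneTwinStarPair)
    (A₁ : EuclideanSpace ℝ (Fin 3) ≃ₗᵢ[ℝ] EuclideanSpace ℝ (Fin 3)) (t₁ : EuclideanSpace ℝ (Fin 3))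
    (A₂ : EuclideanSpace ℝ (Fin 3) ≃ₗᵢ[ℝ] EuclideanSpace ℝ (Fin 3)) (t₂ : EuclideanSpace ℝ (Fin 3))
    {u₁ : EuclideanSpace ℝ (Fin 3)} (hu₁ : u₁ ∈ fccSlots)
    (hsteep₁ : Real.sqrt 2 / 2 ≤ ⟪A₁ u₁, EuclideanSpace.single (2 : Fin 3) (1 : ℝ)⟫_ℝ)
    {u₂ : EuclideanSpace ℝ (Fin 3)} (hu₂ : u₂ ∈ fccSlots)
    (hsteep₂ : ⟪A₂ u₂, EuclideanSpace.single (2 : Fin 3) (1 : ℝ)⟫_ℝ ≤ -(Real.sqrt 2 / 2))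
    (μk μk1 : EuclideanSpace ℝ (Fin 3))
    (hκl : ∀ μ ∈ [μk, μk1], ‖μ‖ = 1 ∧
      ∀ w ∈ fccSlots, ⟪w, μ⟫_ℝ = 0 ∨ ⟪w, μ⟫_ℝ = Real.sqrt (2 / 3) ∨ ⟪w, μ⟫_ℝ = -Real.sqrt (2 / 3))
    (hκc : List.IsChain (fun μ μ' => ⟪μ, μ'⟫_ℝ = 1 / 3 ∨ ⟪μ, μ'⟫_ℝ = -1 / 3) [μk, μk1])
    (hA₁ : A₁ '' fccStacking 1 (Real.sqrt (2 / 3)) = (wordFrame A₂ [μk, μk1]) '' fccStacking 1 (Real.sqrt (2 / 3)))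
    (hfirst : ⟪u₂, μk1⟫_ℝ = 0)
    (hsecond : ∀ n₁ : EuclideanSpace ℝ (Fin 3),
      (n₁ = wordFrame A₂ [μk, μk1] μk ∨ n₁ = -wordFrame A₂ [μk, μk1] μk) → ⟪A₁ u₁, n₁⟫_ℝ = Real.sqrt (2 / 3) →
      ∀ q ∈ fccSlots, 0 < ⟪twinFrame A₁ n₁ q, n₁⟫_ℝ →
        (∀ q' ∈ fccSlots, 0 < ⟪twinFrame A₁ n₁ q', n₁⟫_ℝ →
          ⟪twinFrame A₁ n₁ q', EuclideanSpace.single (2 : Fin 3) (1 : ℝ)⟫_ℝ ≤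
            ⟪twinFrame A₁ n₁ q, EuclideanSpace.single (2 : Fin 3) (1 : ℝ)⟫_ℝ) →
        (wordFrame A₂ [μk, μk1]).symm (A₁ ((twinFrame A₁ n₁).symm ((2 * Real.sqrt (2 / 3)) • twinFrame A₁ n₁ q - n₁))) ≠ μk1 ∧
        (wordFrame A₂ [μk, μk1]).symm (A₁ ((twinFrame A₁ n₁).symm ((2 * Real.sqrt (2 / 3)) • twinFrame A₁ n₁ q - n₁))) ≠ -μk1)
    (hcap : ∀ n₁ : EuclideanSpace ℝ (Fin 3),
      (n₁ = wordFrame A₂ [μk, μk1] μk ∨ n₁ = -wordFrame A₂ [μk, μk1] μk) → ⟪A₁ u₁, n₁⟫_ℝ = Real.sqrt (2 / 3) →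
      ∀ q ∈ fccSlots, 0 < ⟪twinFrame A₁ n₁ q, n₁⟫_ℝ →
        (∀ q' ∈ fccSlots, 0 < ⟪twinFrame A₁ n₁ q', n₁⟫_ℝ →
          ⟪twinFrame A₁ n₁ q', EuclideanSpace.single (2 : Fin 3) (1 : ℝ)⟫_ℝ ≤
            ⟪twinFrame A₁ n₁ q, EuclideanSpace.single (2 : Fin 3) (1 : ℝ)⟫_ℝ) →
        ⟪twinFrame A₁ n₁ q, A₂ μk1⟫_ℝ = 0),
    TwoSlabLedgerWith C 10 1 A₁ t₁ A₂ t₂ := by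
  obtain ⟨K, hK⟩ := twoSlabAdhesionWith_stackLedger_cross
  refine ⟨(240 * Real.sqrt 2 * Real.pi + 4440 * (4 * 10 + 2)) / 2 + 2000 + K, ?_⟩
  intro s₀ hs₀ hcert hfar htw A₁ t₁ A₂ t₂ u₁ hu₁ hsteep₁ u₂ hu₂ hsteep₂ μk μk1 hκl hκc hA₁ hfirst hsecond hcap
  set e₃ : EuclideanSpace ℝ (Fin 3) := EuclideanSpace.single (2 : Fin 3) (1 : ℝ) with he₃
  have hκ2 : 2 ≤ [μk, μk1].length := by simp
  have hfirst' : ∀ μ, [μk, μk1].getLast? = some μ → ⟪u₂, μ⟫_ℝ = 0 := fun μ hμ => by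
    simp at hμ; rw [← hμ]; exact hfirst
  have hsteep₂' : Real.sqrt 2 / 2 ≤ ⟪A₂ u₂, -e₃⟫_ℝ := by rw [inner_neg_right]; linarith only [hsteep₂]
  -- the trivial grain-2 stack (vertical `−e₃`)
  have hS₀ : StackSound (-e₃) [⟨A₂, u₂, 0⟩] := ⟨hu₂, hsteep₂'⟩
  have hW₀ : StackWF (-e₃) [⟨A₂, u₂, 0⟩] := rfl
  -- (a) no grain-2 stack frame is `A₁·Λ₀` (word criterion over the upper frame)
  have hfar₂ : ∀ stk : List WalkEntry, StackSound (-e₃) stk → StackWF (-e₃) stk → stk.getLast? = some ⟨A₂, u₂, 0⟩ →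
      ∀ e ∈ stk, e.frame '' fccStacking 1 (Real.sqrt (2 / 3)) ≠ A₁ '' fccStacking 1 (Real.sqrt (2 / 3)) :=
    fun stk hS hW hl e he => image_ne_of_word [μk, μk1] hκl hκc hκ2 hA₁ hfirst' hS hW hl he
  -- (b) no grain-1 stack frame is `A₂·Λ₀`: it would be co-axial with grain 2's bare bottom, hence the twin of `A₂·Λ₀`
  have hfar₁ : ∀ stk : List WalkEntry, StackSound e₃ stk → StackWF e₃ stk → stk.getLast? = some ⟨A₁, u₁, 0⟩ →
      ∀ e ∈ stk, e.frame '' fccStacking 1 (Real.sqrt (2 / 3)) ≠ A₂ '' fccStacking 1 (Real.sqrt (2 / 3)) := by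
    intro stk hS hW hl e he hEq
    obtain ⟨r, hS', hW', hl'⟩ := exists_suffix_of_mem stk e he hS hW
    rw [hl] at hl'
    have hco := coaxial_linear_of_image_eq (F₁ := (⟨A₂, u₂, 0⟩ : WalkEntry).frame) (F₂ := e.frame) hEq.symm
    obtain ⟨hν, hmenu, himg, -, -⟩ := inPlaneTwin_of_coaxial_sigma9 (A₁ := A₂) (A₂ := A₁) μk μk1 hκl hκc hA₁ hfirst
      hsecond hcap hS₀ hW₀ rfl hS' hW' hl' hco
    exact image_twinFrame_ne A₂ hν hmenu (himg.symm.trans hEq)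
  -- (c) the priced cross pairs (the word analysis with the grains swapped)
  have hledger := hK hs₀ hcert (doubleStarCoaxialAt_of_starPairFar hfar)
    (capPairCoaxial_of_starPairFar hfar) A₁ t₁ A₂ t₂ hu₁ hsteep₁ hu₂ hsteep₂ hfar₁ hfar₂
    (fun stk₁ stk₂ e₁ e₂ rest₁ rest₂ hS₁ hW₁ hl₁ hst₁ hS₂ hW₂ hl₂ hst₂ => by
      by_cases hco : ∃ (L : EuclideanSpace ℝ (Fin 3) ≃ₗᵢ[ℝ] EuclideanSpace ℝ (Fin 3))
          (s₁ s₂ : EuclideanSpace ℝ (Fin 3)) (σ σ' : ℤ → ℤ), IsHaggSeq σ ∧ IsHaggSeq σ' ∧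
          e₁.frame '' fccStacking 1 (Real.sqrt (2 / 3)) ⊆ (fun p => L p + s₁) '' barlowStacking 1 (Real.sqrt (2 / 3)) σ ∧
          e₂.frame '' fccStacking 1 (Real.sqrt (2 / 3)) ⊆ (fun p => L p + s₂) '' barlowStacking 1 (Real.sqrt (2 / 3)) σ'
      · right
        subst hst₁; subst hst₂
        obtain ⟨hν, hmenu, himg, hd₂, hd₁⟩ := inPlaneTwin_of_coaxial_sigma9 (A₁ := A₂) (A₂ := A₁) μk μk1 hκl hκc hA₁
          hfirst hsecond hcap hS₂ hW₂ hl₂ hS₁ hW₁ hl₁ (coaxial_linear_symm hco)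
        intro Y hY y hy hown₁ hown₂
        refine ⟨(starSet_ne_of_inPlaneTwin hν hmenu himg hS₂.top.1 hd₂ (v₂ := e₁.dir) (e := y)).symm, fun q hq hqd => ?_⟩
        rw [Finset.union_comm]
        exact cover_of_inPlaneTwinStarPair htw hY hν hmenu himg hS₂.top.1 hS₁.top.1 hd₂ hd₁ hy hown₂ hown₁ q hq hqd
      · exact Or.inl hco)
  -- (d) the skeleton composition and the charge `½(κ₁ + κ₂) ≥ 1`
  have hκ₁ := one_le_flux_of_steep (A := A₁) (u := u₁) (le_trans hsteep₁ (le_abs_self _))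
  have hκ₂ : 1 ≤ Real.sqrt 2 * |⟪A₂ u₂, EuclideanSpace.single (2 : Fin 3) (1 : ℝ)⟫_ℝ| := by
    refine one_le_flux_of_steep (A := A₂) (u := u₂) ?_
    rw [abs_of_nonpos (by linarith only [hsteep₂, Real.sqrt_nonneg 2] :
      ⟪A₂ u₂, EuclideanSpace.single (2 : Fin 3) (1 : ℝ)⟫_ℝ ≤ 0)]
    linarith only [hsteep₂]
  exact twoSlabLedgerWith_anti (by linarith only [hκ₁, hκ₂]) hledger

/-! ### The class forms -/

/-- **Lower one-sided `Σ9` class at explicit constants**: one `C` with `Sigma9OneSidedAt A₁ A₂ → TwoSlabLedgerWith C 10 1 A₁ t₁ A₂ t₂`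
for all translations (modulo `ExactOnly`(C12-55), `StarPairFar`). -/
theorem twoSlabLedgerWith_of_sigma9OneSidedAt : ∃ C : ℝ, ∀
    {s₀ : EuclideanSpace ℝ (Fin 3)} (hs₀ : s₀ ∈ fccSlots)
    (hcert : ExactOnly 0 (fccSlots.filter fun w => 0 < ⟪w, s₀⟫_ℝ)) (hfar : StarPairFar)
    {A₁ A₂ : EuclideanSpace ℝ (Fin 3) ≃ₗᵢ[ℝ] EuclideanSpace ℝ (Fin 3)} (h : Sigma9OneSidedAt A₁ A₂)
    (t₁ t₂ : EuclideanSpace ℝ (Fin 3)), TwoSlabLedgerWith C 10 1 A₁ t₁ A₂ t₂ := by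
  obtain ⟨C, hC⟩ := twoSlabLedgerWith_one_sigma9_of_far
  refine ⟨C, ?_⟩
  intro s₀ hs₀ hcert hfar A₁ A₂ h t₁ t₂
  obtain ⟨u₁, u₂, μk, μk1, hu₁, hsteep₁, hu₂, hsteep₂, hκl, hκc, hA₂, hfirst, hsecond, hcap⟩ := h
  exact hC hs₀ hcert hfar inPlaneTwinStarPair_holds A₁ t₁ A₂ t₂ hu₁ hsteep₁ hu₂ hsteep₂ μk μk1 hκl hκc hA₂ hfirst hsecond hcap

/-- **Upper one-sided `Σ9` class at explicit constants**: one `C` with `Sigma9OneSidedDownAt A₁ A₂ → TwoSlabLedgerWith C 10 1 A₁ t₁ A₂ t₂`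
for all translations (modulo `ExactOnly`(C12-55), `StarPairFar`). -/
theorem twoSlabLedgerWith_of_sigma9OneSidedDownAt : ∃ C : ℝ, ∀
    {s₀ : EuclideanSpace ℝ (Fin 3)} (hs₀ : s₀ ∈ fccSlots)
    (hcert : ExactOnly 0 (fccSlots.filter fun w => 0 < ⟪w, s₀⟫_ℝ)) (hfar : StarPairFar)
    {A₁ A₂ : EuclideanSpace ℝ (Fin 3) ≃ₗᵢ[ℝ] EuclideanSpace ℝ (Fin 3)} (h : Sigma9OneSidedDownAt A₁ A₂)
    (t₁ t₂ : EuclideanSpace ℝ (Fin 3)), TwoSlabLedgerWith C 10 1 A₁ t₁ A₂ t₂ := by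
  obtain ⟨C, hC⟩ := twoSlabLedgerWith_one_sigma9Down_of_far
  refine ⟨C, ?_⟩
  intro s₀ hs₀ hcert hfar A₁ A₂ h t₁ t₂
  obtain ⟨u₁, u₂, μk, μk1, hu₁, hsteep₁, hu₂, hsteep₂, hκl, hκc, hA₁, hfirst, hsecond, hcap⟩ := h
  exact hC hs₀ hcert hfar inPlaneTwinStarPair_holds A₁ t₁ A₂ t₂ hu₁ hsteep₁ hu₂ hsteep₂ μk μk1 hκl hκc hA₁ hfirst hsecond hcap

end Summit.Ventures.Crystal3D.Theorems

end
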